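import Summits.CriticalPhenomena.PercolationContinuityZ3.Theorems.PercNearOneGluingNoHeavyLowerTailSahiCTCN2Five
import Summits.CriticalPhenomena.PercolationContinuityZ3.Theorems.PercNearOneGluingNoHeavyLowerTailSahiCTCN3FiveTab
import Summits.CriticalPhenomena.PercolationContinuityZ3.Theorems.PercNearOneGluingNoHeavyLowerTailSahiCTCNcSymm
import HarnessLib

/-!
# `NoHeavyLowerTail` (crux stmt-CriticalPhenomena-4575), P3 lane: the level-3 coefficientwise threshold certificate on FIVE points —
# the coded ENUMERATION of level-3 configurations, its canonical filter and its SOUNDNESS (`Ñ₃ ∈ ℕ[r]` from five finite checks)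

Support file (seat `prim-l12-p3`, gen 21; `--supports stmt-CriticalPhenomena-4575`; `--computational`: two small coding facts by `native_decide` /
`decide`; the enumeration itself runs in the companion files).  Memo `run/shared/lean/prim/prim-l12/FROM-prim-l12-p3-g21-*.md`.

**THEOREM `coeff_Ngen3_nonneg_fin5_of_checks`.**  For all down-sets `K_X, K_Z ⊆ 2^{Fin 5}` containing `∅`, every coefficient of the level-3 certificate
polynomial `Ñ₃(K_X,K_Z) = Ngen 3 K_X K_Z` (`…SahiCTCNcGen`, g9's form (A) of the `(TC)` row of the threshold certificate
`ρ₃ = μ(· | exactly three closed)`) is `≥ 0`.  This is the conjecture (CTC) of the programme (memo g9 §1) at `k = 5`, `c = 3` — the case of the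
first slot "at least two of five open" (`Th₂⁵`).
PROOF.  `…SahiCTCN3NormalForm.coeff_Ngen3_nonneg_of_configs` reduces to level-3 configurations `(L_X, L_Z, A, B, T_X, T_Z)`; these are coded by
bit masks (`encS`, `encE` of `…SahiCTCN2Five`, `encT` for triangle sets), relabelling by `S₅` and the swap `X ↔ Z` act on codes through
precomputed tables (`permTabs3`), and `checkAll3` verifies — for every valid code that is lexicographically minimal in its orbit (`isCanon3`) — that
the coefficient table `…SahiCTCN3FiveTab.n3Tab` of the configuration is entrywise `≥ 0` (`291 499` valid codes, `1 989` canonical ones, `3125`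
coefficients each; the table checks are split into five parts `checkAll3 p`, `p < 5`, each discharged by `native_decide` in its own companion
file `…SahiCTCN3FiveCheck<p>`; the unconditional theorem is assembled in `…SahiCTCN3Five`).  Soundness (`flagGood3_of_code`) is a strong
induction on the code, exactly as in `…SahiCTCN2Five`.  Triangle masks of coded graphs are computed on codes (`triBits_eq`).  Nothing is
asserted about the crux.
-/

namespace Summit.CriticalPhenomena.PercolationContinuityZ3.Theorems.SahiCTCForms

open Finset MvPolynomial SahiCTCGenFun

namespace N3Five

open N2Five

/-! ### Codes of triangle sets -/

/-- The ten 3-subsets of `Fin 5`. [this work] -/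
def triList : List (Finset (Fin 5)) :=
  [{0, 1, 2}, {0, 1, 3}, {0, 2, 3}, {1, 2, 3}, {0, 1, 4}, {0, 2, 4}, {1, 2, 4}, {0, 3, 4}, {1, 3, 4}, {2, 3, 4}]

/-- The `t`-th triple (junk `∅` out of range). [this work] -/
def triAt (t : ℕ) : Finset (Fin 5) := triList.getD t ∅

/-- The bit positions of a triangle set. [this work] -/
def idxT (T : Finset (Finset (Fin 5))) : Finset ℕ := (range 10).filter fun t => triAt t ∈ T

/-- The bit code of a triangle set. [this work] -/
def encT (T : Finset (Finset (Fin 5))) : ℕ := ∑ t ∈ idxT T, 2 ^ t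

/-- The triangle set with bit code `x`. [this work] -/
def decodeTris (x : ℕ) : Finset (Finset (Fin 5)) := ((range 10).filter fun t => x.testBit t).image triAt

/-- Bits of `encT`. [this work] -/
theorem testBit_encT (T : Finset (Finset (Fin 5))) (i : ℕ) : (encT T).testBit i ↔ i ∈ idxT T := by
  rw [encT, testBit_sum_two_pow]

/-- CODING FACT: every 3-subset of `Fin 5` is listed. [this work] -/
theorem exists_triAt : ∀ t : Finset (Fin 5), #t = 3 → ∃ i ∈ range 10, triAt i = t := by native_decide

/-- Triangle codes are `< 1024`. [this work] -/
theorem encT_lt (T : Finset (Finset (Fin 5))) : encT T < 1024 := by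
  refine Nat.lt_pow_two_of_testBit (n := 10) _ fun i hi => ?_
  rw [Bool.eq_false_iff, ne_eq, testBit_encT]
  intro h
  have := mem_range.1 (mem_filter.1 h).1
  omega

/-- `decodeTris ∘ encT = id` on sets of 3-subsets. [this work] -/
theorem decodeTris_encT {T : Finset (Finset (Fin 5))} (hT : ∀ t ∈ T, #t = 3) : decodeTris (encT T) = T := by
  ext t
  simp only [decodeTris, mem_image, mem_filter, mem_range, testBit_encT, idxT]
  constructor
  · rintro ⟨i, ⟨_, _, hi⟩, rfl⟩; exact hi
  · intro ht
    obtain ⟨i, hi, rfl⟩ := exists_triAt t (hT t ht)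
    exact ⟨i, ⟨mem_range.1 hi, mem_range.1 hi, ht⟩, rfl⟩

/-- Subfamilies have sub-masks (triangles). [this work] -/
theorem maskT_subset {A P : Finset (Finset (Fin 5))} (h : A ⊆ P) : encT A ||| encT P = encT P := by
  refine or_eq_of_testBit fun i => ?_
  rcases Bool.eq_false_or_eq_true ((encT A).testBit i) with hA | hA
  · have hP : (encT P).testBit i = true := by
      rw [testBit_encT] at hA ⊢; exact mem_filter.2 ⟨(mem_filter.1 hA).1, h (mem_filter.1 hA).2⟩
    rw [hA, hP]; rfl
  · rw [hA]; exact Bool.false_or _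

/-- `encT` of a union is the bitwise or. [this work] -/
theorem encT_union (A B : Finset (Finset (Fin 5))) : encT (A ∪ B) = encT A ||| encT B := by
  symm
  refine or_eq_of_testBit fun i => ?_
  apply Bool.eq_iff_iff.2
  rw [Bool.or_eq_true_iff]
  simp only [testBit_encT, idxT, mem_filter, mem_union]
  tauto

/-! ### Sub-mask lists -/

/-- The sub-masks of each 10-bit mask. [this work] -/
def subTab : Array (List ℕ) := Array.ofFn (n := 1024) fun m => (List.range 1024).filter fun s => s ||| m.val = m.val

/-- Membership in `subTab`. [this work] -/
theorem mem_subTab {m s : ℕ} (hm : m < 1024) (hs : s < 1024) (h : s ||| m = m) : s ∈ subTab.getD m [] := by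
  rw [subTab, getD_ofFn _ _ hm, List.mem_filter, List.mem_range]
  exact ⟨hs, decide_eq_true h⟩

/-! ### Configurations, the canonical filter, the enumeration -/

/-- The `X`-pairs coded by `(lx, lz, a)`. [this work] -/
def cxEX (lx lz a : ℕ) : Finset (Finset (Fin 5)) := privPairs (decodeSet lx) (decodeSet lz) ∪ decodeEdges a

/-- The `Z`-pairs coded by `(lx, lz, b)`. [this work] -/
def cxEZ (lx lz b : ℕ) : Finset (Finset (Fin 5)) := privPairs (decodeSet lz) (decodeSet lx) ∪ decodeEdges b

/-- The level-3 `X`-complex coded by `(lx, lz, a, tx)`. [this work] -/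
def cxX3 (lx lz a tx : ℕ) : Finset (Finset (Fin 5)) := flagCx3 (decodeSet lx) (cxEX lx lz a) (decodeTris tx)

/-- The level-3 `Z`-complex coded by `(lx, lz, b, tz)`. [this work] -/
def cxZ3 (lx lz b tz : ℕ) : Finset (Finset (Fin 5)) := flagCx3 (decodeSet lz) (cxEZ lx lz b) (decodeTris tz)

/-! ### Triangle masks of coded graphs, computed on codes -/

/-- `encE` of a union is the bitwise or. [this work] -/
theorem encE_union (A B : Finset (Finset (Fin 5))) : encE (A ∪ B) = encE A ||| encE B := by
  symm
  refine or_eq_of_testBit fun i => ?_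
  apply Bool.eq_iff_iff.2
  rw [Bool.or_eq_true_iff]
  simp only [testBit_encE, idxE, mem_filter, mem_union]
  tauto

/-- `encS A &&& encS B = encS A` iff `A ⊆ B`. [this work] -/
theorem and_encS_eq_iff (A B : Finset (Fin 5)) : encS A &&& encS B = encS A ↔ A ⊆ B := by
  constructor
  · intro h x hx
    have hb := congrArg (fun n => n.testBit (x : ℕ)) h
    simp only [Nat.testBit_and] at hb
    have hxA : (encS A).testBit (x : ℕ) = true := (testBit_encS A x).2 (mem_map.2 ⟨x, hx, rfl⟩)
    rw [hxA, Bool.true_and] at hb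
    obtain ⟨y, hy, hyx⟩ := mem_map.1 ((testBit_encS B x).1 hb)
    have : y = x := Fin.ext hyx
    exact this ▸ hy
  · intro h
    refine Nat.eq_of_testBit_eq fun i => ?_
    rw [Nat.testBit_and]
    rcases Bool.eq_false_or_eq_true ((encS A).testBit i) with hA | hA
    · have hB : (encS B).testBit i = true := by
        obtain ⟨y, hy, rfl⟩ := mem_map.1 ((testBit_encS A i).1 hA)
        exact (testBit_encS B _).2 (mem_map.2 ⟨y, h hy, rfl⟩)
      rw [hA, hB]; rfl
    · rw [hA]; rfl

/-- `encE A &&& encE B = encE A` iff `A ⊆ B`, for sets of 2-subsets. [this work] -/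
theorem and_encE_eq_iff {A : Finset (Finset (Fin 5))} (B : Finset (Finset (Fin 5))) (hA : A ⊆ pairsIn (univ : Finset (Fin 5))) :
    encE A &&& encE B = encE A ↔ A ⊆ B := by
  constructor
  · intro h e he
    obtain ⟨j, hj, rfl⟩ := exists_pairAt e (hA he)
    have hb := congrArg (fun n => n.testBit j) h
    simp only [Nat.testBit_and] at hb
    have hjA : (encE A).testBit j = true := (testBit_encE A j).2 (mem_filter.2 ⟨hj, he⟩)
    rw [hjA, Bool.true_and] at hb
    exact (mem_filter.1 ((testBit_encE B j).1 hb)).2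
  · intro h
    refine Nat.eq_of_testBit_eq fun i => ?_
    rw [Nat.testBit_and]
    rcases Bool.eq_false_or_eq_true ((encE A).testBit i) with hAi | hAi
    · have hB : (encE B).testBit i = true := by
        rw [testBit_encE] at hAi ⊢; exact mem_filter.2 ⟨(mem_filter.1 hAi).1, h (mem_filter.1 hAi).2⟩
      rw [hAi, hB]; rfl
    · rw [hAi]; rfl

/-- Vertex masks of the ten triples. [this work] -/
def triVTab : Array ℕ := Array.ofFn (n := 10) fun t => encS (triAt t.val)

/-- The 2-subsets of the `t`-th triple. [this work] -/
def triPairs (t : ℕ) : Finset (Finset (Fin 5)) := (pairsIn (univ : Finset (Fin 5))).filter fun e => e ⊆ triAt t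

/-- `triPairs t ⊆ pairs(univ)`. [this work] -/
theorem triPairs_subset (t : ℕ) : triPairs t ⊆ pairsIn (univ : Finset (Fin 5)) := filter_subset _ _

/-- Edge masks of the ten triples. [this work] -/
def triETab : Array ℕ := Array.ofFn (n := 10) fun t => encE (triPairs t.val)

/-- Edge masks of the private pairs of each live pattern. [this work] -/
def privTab : Array ℕ := Array.ofFn (n := 1024) fun c => encE (privPairs (decodeSet (c.val / 32)) (decodeSet (c.val % 32)))

/-- The triangle mask of the graph with vertex mask `lm` and edge mask `em`, computed on codes. [this work] -/
def triBits (lm em : ℕ) : ℕ :=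
  ∑ t ∈ (range 10).filter (fun t => triVTab.getD t 0 &&& lm = triVTab.getD t 0 ∧ triETab.getD t 0 &&& em = triETab.getD t 0), 2 ^ t

/-- The mask of the triangles of the coded `X`-graph. [this work] -/
def txMask (lx lz a : ℕ) : ℕ := triBits lx (privTab.getD (lx * 32 + lz) 0 ||| a)

/-- The mask of the triangles of the coded `Z`-graph. [this work] -/
def tzMask (lx lz b : ℕ) : ℕ := triBits lz (privTab.getD (lz * 32 + lx) 0 ||| b)

/-- CODING FACT: the listed triples have three elements. [this work] -/
theorem card_triAt : ∀ i ∈ range 10, #(triAt i) = 3 := by decide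

/-- **`triBits` computes `encT ∘ tri` on codes.** [this work] -/
theorem triBits_eq (L : Finset (Fin 5)) (E : Finset (Finset (Fin 5))) : triBits (encS L) (encE E) = encT (tri L E) := by
  refine Nat.eq_of_testBit_eq fun i => ?_
  apply Bool.eq_iff_iff.2
  rw [triBits, testBit_sum_two_pow, testBit_encT, idxT, mem_filter, mem_filter, mem_range, mem_tri]
  constructor
  · rintro ⟨hi, hV, hE'⟩
    rw [triVTab, getD_ofFn _ _ hi, and_encS_eq_iff] at hV
    rw [triETab, getD_ofFn _ _ hi, and_encE_eq_iff E (triPairs_subset _)] at hE'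
    refine ⟨hi, card_triAt i (mem_range.2 hi), hV, fun e he h2 => hE' ?_⟩
    exact mem_filter.2 ⟨mem_filter.2 ⟨mem_powerset.2 (subset_univ _), h2, subset_univ _⟩, he⟩
  · rintro ⟨hi, -, hV, hE'⟩
    refine ⟨hi, ?_, ?_⟩
    · rw [triVTab, getD_ofFn _ _ hi, and_encS_eq_iff]; exact hV
    · rw [triETab, getD_ofFn _ _ hi, and_encE_eq_iff E (triPairs_subset _)]
      intro e he
      obtain ⟨he1, he2⟩ := mem_filter.1 he
      exact hE' e he2 (mem_filter.1 he1).2.1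

/-- `privTab` lookup. [this work] -/
theorem privTab_get (LX LZ : Finset (Fin 5)) : privTab.getD (encS LX * 32 + encS LZ) 0 = encE (privPairs LX LZ) := by
  obtain ⟨hX, hX'⟩ := decodeSet_encS LX
  obtain ⟨hZ, hZ'⟩ := decodeSet_encS LZ
  rw [privTab, getD_ofFn _ _ (by omega)]
  dsimp only
  rw [show (encS LX * 32 + encS LZ) / 32 = encS LX by omega, show (encS LX * 32 + encS LZ) % 32 = encS LZ by omega, hX, hZ]

/-- **The coded `X`-triangle mask is the mask of the triangles of the `X`-graph.** [this work] -/
theorem txMask_eq (LX LZ : Finset (Fin 5)) (A : Finset (Finset (Fin 5))) :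
    txMask (encS LX) (encS LZ) (encE A) = encT (tri LX (privPairs LX LZ ∪ A)) := by
  rw [txMask, privTab_get, ← encE_union, triBits_eq]

/-- **The coded `Z`-triangle mask is the mask of the triangles of the `Z`-graph.** [this work] -/
theorem tzMask_eq (LX LZ : Finset (Fin 5)) (B : Finset (Finset (Fin 5))) :
    tzMask (encS LX) (encS LZ) (encE B) = encT (tri LZ (privPairs LZ LX ∪ B)) := by
  rw [tzMask, privTab_get, ← encE_union, triBits_eq]

/-- The table check of one coded level-3 configuration. [this work] -/
def checkConfig3 (lx lz a b tx tz : ℕ) : Bool := tabNonneg (n3Tab (cxX3 lx lz a tx) (cxZ3 lx lz b tz))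

/-- The single numeric code of a level-3 configuration (lexicographic in `lx, lz, a, b, tx, tz`). [this work] -/
def code6 (lx lz a b tx tz : ℕ) : ℕ := ((((lx * 32 + lz) * 1024 + a) * 1024 + b) * 1024 + tx) * 1024 + tz

/-- Vertex-, edge- and triangle-mask image tables of a relabelling. [this work] -/
def permTab3 (σ : Equiv.Perm (Fin 5)) : Array ℕ × Array ℕ × Array ℕ :=
  (Array.ofFn (n := 32) fun m => encS ((decodeSet m.val).map σ.toEmbedding),
   Array.ofFn (n := 1024) fun a => encE ((decodeEdges a.val).map σ.finsetCongr.toEmbedding),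
   Array.ofFn (n := 1024) fun x => encT ((decodeTris x.val).map σ.finsetCongr.toEmbedding))

/-- All image tables. [this work] -/
def permTabs3 : List (Array ℕ × Array ℕ × Array ℕ) := perms.map permTab3

/-- The configuration code is minimal in its orbit under relabellings and the swap. [this work] -/
def isCanon3 (lx lz a b tx tz : ℕ) : Bool :=
  permTabs3.all fun T =>
    decide (code6 lx lz a b tx tz ≤
      code6 (T.1.getD lx 0) (T.1.getD lz 0) (T.2.1.getD a 0) (T.2.1.getD b 0) (T.2.2.getD tx 0) (T.2.2.getD tz 0)) &&
    decide (code6 lx lz a b tx tz ≤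
      code6 (T.1.getD lz 0) (T.1.getD lx 0) (T.2.1.getD b 0) (T.2.1.getD a 0) (T.2.2.getD tz 0) (T.2.2.getD tx 0))

/-- The part of the work list a configuration belongs to (the table checks are split into `5` files). [this work] -/
def partOf (a b tx tz : ℕ) : ℕ := (a * 3 + b * 5 + tx * 7 + tz * 11) % 5

/-- Check a configuration if it is canonical and belongs to part `p`. [this work] -/
def checkIfCanon3 (p lx lz a b tx tz : ℕ) : Bool :=
  if isCanon3 lx lz a b tx tz = true ∧ partOf a b tx tz = p then checkConfig3 lx lz a b tx tz else true

/-- The triangle stage of the enumeration: `tx ⊆ TX`, `tz ⊆ TZ`, `TX ∪ TZ ⊆ tx ∪ tz`. [this work] -/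
def checkTri (p lx lz a b TX TZ : ℕ) : Bool :=
  (subTab.getD TX []).all fun tx => (subTab.getD TZ []).all fun tz =>
    if (TX ||| TZ) ||| (tx ||| tz) = tx ||| tz then checkIfCanon3 p lx lz a b tx tz else true

/-- **The enumeration** (part `p` of `5`): all valid level-3 configuration codes of part `p` pass `checkIfCanon3`.  The five facts
`checkAll3 p = true` are proved by `native_decide` in the companion files `…SahiCTCN3FiveCheck0` … `…Check4`. [this work] -/
def checkAll3 (p : ℕ) : Bool :=
  (List.range 32).all fun lx => (List.range 32).all fun lz =>
    if lx ||| lz = 31 then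
      (List.range 1024).all fun a =>
        if a ||| bothTab.getD (lx * 32 + lz) 0 = bothTab.getD (lx * 32 + lz) 0 then
          (List.range 1024).all fun b =>
            if b ||| bothTab.getD (lx * 32 + lz) 0 = bothTab.getD (lx * 32 + lz) 0 ∧ a ||| b = bothTab.getD (lx * 32 + lz) 0 then
              checkTri p lx lz a b (txMask lx lz a) (tzMask lx lz b) else true
        else true
    else true

/-- Unpacking the enumeration. [this work] -/
theorem checkConfig3_of_checkAll3 {lx lz a b tx tz : ℕ} (hall : checkAll3 (partOf a b tx tz) = true) (hlx : lx < 32) (hlz : lz < 32)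
    (ha : a < 1024) (hb : b < 1024)
    (h1 : lx ||| lz = 31) (h2 : a ||| bothTab.getD (lx * 32 + lz) 0 = bothTab.getD (lx * 32 + lz) 0)
    (h3 : b ||| bothTab.getD (lx * 32 + lz) 0 = bothTab.getD (lx * 32 + lz) 0) (h4 : a ||| b = bothTab.getD (lx * 32 + lz) 0)
    (htx : tx ∈ subTab.getD (txMask lx lz a) []) (htz : tz ∈ subTab.getD (tzMask lx lz b) [])
    (h7 : (txMask lx lz a ||| tzMask lx lz b) ||| (tx ||| tz) = tx ||| tz)
    (hc : isCanon3 lx lz a b tx tz = true) : checkConfig3 lx lz a b tx tz = true := by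
  have h := hall
  unfold checkAll3 at h
  rw [List.all_eq_true] at h
  have h := h lx (List.mem_range.2 hlx)
  rw [List.all_eq_true] at h
  have h := h lz (List.mem_range.2 hlz)
  rw [if_pos h1, List.all_eq_true] at h
  have h := h a (List.mem_range.2 ha)
  rw [if_pos h2, List.all_eq_true] at h
  have h := h b (List.mem_range.2 hb)
  rw [if_pos ⟨h3, h4⟩] at h
  unfold checkTri at h
  rw [List.all_eq_true] at h
  have h := h tx htx
  rw [List.all_eq_true] at h
  have h := h tz htz
  rw [if_pos h7, checkIfCanon3, if_pos ⟨hc, rfl⟩] at h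
  exact h

/-! ### Soundness -/

section sound

/-- Members of triangle families are 3-sets. [this work] -/
theorem card_of_mem_tri {L : Finset (Fin 5)} {E : Finset (Finset (Fin 5))} {T : Finset (Finset (Fin 5))} (h : T ⊆ tri L E) :
    ∀ t ∈ T, #t = 3 := fun _ ht => (mem_tri.1 (h ht)).1

/-- **Soundness of the symmetric enumeration**: every valid level-3 configuration on `Fin 5` has `Ñ₃ ∈ ℕ[r]`. [this work] -/
theorem flagGood3_of_code (hall : ∀ p < 5, checkAll3 p = true) : ∀ (c : ℕ) (LX LZ : Finset (Fin 5)) (A B TX TZ : Finset (Finset (Fin 5))),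
    code6 (encS LX) (encS LZ) (encE A) (encE B) (encT TX) (encT TZ) = c →
    (LX ∪ LZ = univ ∧ A ⊆ pairsIn (LX ∩ LZ) ∧ B ⊆ pairsIn (LX ∩ LZ) ∧ pairsIn (LX ∩ LZ) ⊆ A ∪ B ∧
      TX ⊆ tri LX (privPairs LX LZ ∪ A) ∧ TZ ⊆ tri LZ (privPairs LZ LX ∪ B) ∧
      tri LX (privPairs LX LZ ∪ A) ∪ tri LZ (privPairs LZ LX ∪ B) ⊆ TX ∪ TZ) →
    ∀ n, 0 ≤ (Ngen 3 (flagCx3 LX (privPairs LX LZ ∪ A) TX) (flagCx3 LZ (privPairs LZ LX ∪ B) TZ)).coeff n := by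
  intro c
  induction c using Nat.strong_induction_on with
  | _ c ih =>
  intro LX LZ A B TX TZ hc hv
  obtain ⟨h1, h2, h3, h4, h5, h6, h7⟩ := hv
  obtain ⟨dX, lX⟩ := decodeSet_encS LX
  obtain ⟨dZ, lZ⟩ := decodeSet_encS LZ
  have dA := decodeEdges_encE (subset_pairsIn_univ h2)
  have lA := encE_lt A
  have dB := decodeEdges_encE (subset_pairsIn_univ h3)
  have lB := encE_lt B
  have dTX := decodeTris_encT (card_of_mem_tri h5)
  have lTX := encT_lt TX
  have dTZ := decodeTris_encT (card_of_mem_tri h6)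
  have lTZ := encT_lt TZ
  by_cases hcan : isCanon3 (encS LX) (encS LZ) (encE A) (encE B) (encT TX) (encT TZ) = true
  · -- canonical: the table check was run
    have hTXm : txMask (encS LX) (encS LZ) (encE A) = encT (tri LX (privPairs LX LZ ∪ A)) := txMask_eq LX LZ A
    have hTZm : tzMask (encS LX) (encS LZ) (encE B) = encT (tri LZ (privPairs LZ LX ∪ B)) := tzMask_eq LX LZ B
    have htx : encT TX ∈ subTab.getD (txMask (encS LX) (encS LZ) (encE A)) [] := by
      rw [hTXm]; exact mem_subTab (encT_lt _) lTX (maskT_subset h5)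
    have htz : encT TZ ∈ subTab.getD (tzMask (encS LX) (encS LZ) (encE B)) [] := by
      rw [hTZm]; exact mem_subTab (encT_lt _) lTZ (maskT_subset h6)
    have h7' : (txMask (encS LX) (encS LZ) (encE A) ||| tzMask (encS LX) (encS LZ) (encE B)) ||| (encT TX ||| encT TZ) = encT TX ||| encT TZ := by
      rw [hTXm, hTZm, ← encT_union, ← encT_union]; exact maskT_subset h7
    have hchk := checkConfig3_of_checkAll3 (hall _ (Nat.mod_lt _ (by norm_num))) lX lZ lA lB (mask_union h1) (by rw [bothTab_get]; exact mask_subset h2)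
      (by rw [bothTab_get]; exact mask_subset h3) (by rw [bothTab_get]; exact mask_cover h2 h3 h4) htx htz h7' hcan
    rw [checkConfig3, cxX3, cxZ3, cxEX, cxEZ, dX, dZ, dA, dB, dTX, dTZ] at hchk
    exact coeff_Ngen3_nonneg_of_tabNonneg hchk
  · -- not canonical: some relabelling (possibly swapped) has a smaller code
    rw [isCanon3, Bool.not_eq_true, List.all_eq_false] at hcan
    obtain ⟨T, hT, hlt⟩ := hcan
    obtain ⟨σ, _, rfl⟩ := List.mem_map.1 hT
    simp only [permTab3, getD_ofFn _ _ lX, getD_ofFn _ _ lZ, getD_ofFn _ _ lA, getD_ofFn _ _ lB, getD_ofFn _ _ lTX, getD_ofFn _ _ lTZ,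
      dX, dZ, dA, dB, dTX, dTZ, Bool.and_eq_true, decide_eq_true_eq, not_and_or, not_le] at hlt
    have hv' := flagValid3_map σ h1 h2 h3 h4 h5 h6 h7
    rcases hlt with hlt | hlt
    · exact flagGood3_of_map σ (ih _ (hc ▸ hlt) _ _ _ _ _ _ rfl hv')
    · exact flagGood3_of_map σ (flagGood3_swap (ih _ (hc ▸ hlt) _ _ _ _ _ _ rfl (valid3_swap hv')))

end sound

/-- **The level-3 coefficientwise threshold certificate on five points, from the five finite checks.**  If `checkAll3 p = true` for all
`p < 5` (the companion files `…SahiCTCN3FiveCheck0…4`), then for all simplicial complexes (down-sets containing `∅`) `K_X, K_Z` on `Fin 5`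
every coefficient of `Ñ₃(K_X, K_Z)` is nonnegative.  Assembled unconditionally in `…SahiCTCN3Five`. [this work] -/
theorem coeff_Ngen3_nonneg_fin5_of_checks (hall : ∀ p < 5, checkAll3 p = true) {KX KZ : Finset (Finset (Fin 5))}
    (hKX : IsLowerSet (KX : Set (Finset (Fin 5)))) (hKZ : IsLowerSet (KZ : Set (Finset (Fin 5)))) (h0X : ∅ ∈ KX) (h0Z : ∅ ∈ KZ)
    (n : Fin 5 →₀ ℕ) : 0 ≤ (Ngen 3 KX KZ).coeff n :=
  coeff_Ngen3_nonneg_of_configs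
    (fun LX LZ A B TX TZ h1 h2 h3 h4 h5 h6 h7 => flagGood3_of_code hall _ LX LZ A B TX TZ rfl ⟨h1, h2, h3, h4, h5, h6, h7⟩) hKX hKZ h0X h0Z n

end N3Five

end Summit.CriticalPhenomena.PercolationContinuityZ3.Theorems.SahiCTCForms
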